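import Summits.Ventures.Crystal3D.Theorems.StickyWulffConstantPolycrystalWulffBoundBodyChange
import Summits.Ventures.Crystal3D.Theorems.StickyWulffConstantPolycrystalWulffBoundBlockPincer

/-!
# `PolycrystalWulffBound`, line `PolyDensity`: the LP rows BLOCK / FLOOR for a single block of grains

Route `StickyWulffConstant` of the venture `Summits/Ventures/Crystal3D`, crux `PolycrystalWulffBound`
(item `stmt-Ventures-19482`), second prover lane (poly-p2, gen 4).  The middle-band LP (HOME/poly-p2/
MIDDLE-BAND-g4.md §8, box certificate BOXCERT3-27.80) is written in BLOCK free energies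
`F_B = Σ_{f ∈ B} Fr_f` (`Fr_f = per K_f (G f) − Σ_{g ≠ f} ι_{K_f}(G f, G g)`), one variable per block, so its
rows must bound `F_B` for ONE Finset `B` of grains — not only the total free energy as in
`block_wulff_le_freeEnergy` / `freeEnergy_ge_mul_perimeter`.  For pairwise disjoint polyhedral grains of
finite perimeter and volume with origin-symmetric compact convex bodies `K_f ∋ 0`:

* `blockFreeEnergy_mono` — `Σ_{f∈B} Fr_f(K′) ≤ Σ_{f∈B} Fr_f(K)` when `K′_f ⊆ K_f` on `B` (grain by grain);
* `block_wulff_le_blockFreeEnergy` — for a body `KB ∋ 0` (origin-symmetric compact convex, `KB ⊆ B̄(0,R)`)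
  with `KB ⊆ K_f` for `f ∈ B`:  `3·|KB|^{1/3}·|E_B|^{2/3} − R · Σ_{f∈B} Σ_{g∉B} ι_{B̄(0,1)}(G f, G g) ≤ F_B`
  (rows «block(B)» and, with `KB ∩ B̄(0,√(5−ε))`, «shv_ε(B)»);
* `floor_le_blockFreeEnergy` — `r · Σ_{f∈B} Y_f ≤ F_B` when `B̄(0,r) ⊆ K_f` on `B` (rows «floor»), `Y_f` the
  free Euclidean area.
WHAT THIS IS NOT: the recolouring/isoperimetric rows (`recolour_move`, `per_biUnion_eq_sum_sub_sum_iota`);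
a rung; F-C1 not moved.
-/

noncomputable section

namespace Summit.Ventures.Crystal3D.Theorems

open MeasureTheory Set Metric
open scoped RealInnerProductSpace ENNReal Pointwise
open Summit.Ventures.Crystal3D.Cruxes.TextureLiminf.TexShadow
open Literature.Analysis.Convexity
open Literature.MathematicalPhysics.StatisticalMechanics (perimeter HasFinitePerimeter)

/-- **Block free energy is monotone in the bodies**: if `K′_f ⊆ K_f` for every `f ∈ B` then
`Σ_{f∈B} Fr_f(K′) ≤ Σ_{f∈B} Fr_f(K)`. -/
theorem blockFreeEnergy_mono {n : ℕ} (G : Fin n → Set E3)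
    (hPoly : ∀ f, ∃ (k : ℕ) (H : Fin k → Finset (E3 × ℝ)), G f = ⋃ i, polytope (H i))
    (hvol : ∀ f, volume (G f) < ⊤) (hdisjG : ∀ f g, f ≠ g → Disjoint (G f) (G g))
    (Kf : Fin n → Set E3) (hKc : ∀ f, IsCompact (Kf f)) (hKv : ∀ f, Convex ℝ (Kf f))
    (hK0 : ∀ f, (0 : E3) ∈ Kf f) (hKs : ∀ f, -Kf f = Kf f)
    (Kf' : Fin n → Set E3) (hKc' : ∀ f, IsCompact (Kf' f)) (hKv' : ∀ f, Convex ℝ (Kf' f))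
    (hK0' : ∀ f, (0 : E3) ∈ Kf' f) (hKs' : ∀ f, -Kf' f = Kf' f) (B : Finset (Fin n))
    (hsub : ∀ f ∈ B, Kf' f ⊆ Kf f) :
    (∑ f ∈ B, (per (Kf' f) (G f) - ∑ g, (if f = g then 0 else
        (per (Kf' f) (G f) + per (Kf' f) (G g) - per (Kf' f) (G f ∪ G g)) / 2))) ≤
      ∑ f ∈ B, (per (Kf f) (G f) - ∑ g, (if f = g then 0 else
        (per (Kf f) (G f) + per (Kf f) (G g) - per (Kf f) (G f ∪ G g)) / 2)) := by
  obtain ⟨k, H, ν, S, SX, -, hext, -⟩ := exists_exterior_crossSums G hPoly hvol hdisjG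
  set X : Set E3 → Fin k → Fin k → ℝ := fun K a b =>
    (if a < b then (supportFn K (ν a b) + supportFn K (-ν a b)) *
        facetArea (closure (polytope (H a)) ∩ closure (polytope (H b))) (ν a b)
      else (supportFn K (ν b a) + supportFn K (-ν b a)) *
        facetArea (closure (polytope (H b)) ∩ closure (polytope (H a))) (ν b a)) with hX
  have hf : ∀ (K : Set E3), IsCompact K → Convex ℝ K → (0 : E3) ∈ K → -K = K → ∀ f,
      per K (G f) - ∑ g, (if f = g then 0 else
        (per K (G f) + per K (G g) - per K (G f ∪ G g)) / 2) =
      (∑ a ∈ S f, ∑ b ∈ SX, X K a b) / 2 := by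
    intro K hK hKv0 hK00 hKs0 f
    have h : 2 * per K (G f) = (∑ g ∈ Finset.univ.erase f,
        (per K (G f) + per K (G g) - per K (G f ∪ G g))) +
        ∑ a ∈ S f, ∑ b ∈ SX, X K a b := hext K hK hKv0 hK00 hKs0 f
    rw [sum_ite_eq_sum_erase_div_two]
    linarith
  refine Finset.sum_le_sum fun f hfB => ?_
  rw [hf (Kf' f) (hKc' f) (hKv' f) (hK0' f) (hKs' f) f, hf (Kf f) (hKc f) (hKv f) (hK0 f) (hKs f) f]
  exact div_le_div_of_nonneg_right
    (crossSum_mono (hsub f hfB) (hKc f).isBounded ⟨0, hK0' f⟩ H ν (S f) SX) zero_le_two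

/-- **Row «block(B)»**: Wulff's inequality for one block with body `KB`, its interfaces with the other
grains over-counted by at most `R` per unit Euclidean area. -/
theorem block_wulff_le_blockFreeEnergy {n : ℕ} (G : Fin n → Set E3)
    (hfin : ∀ f, HasFinitePerimeter (G f) ∧ volume (G f) < ⊤)
    (hPoly : ∀ f, ∃ (k : ℕ) (H : Fin k → Finset (E3 × ℝ)), G f = ⋃ i, polytope (H i))
    (hdisjG : ∀ f g, f ≠ g → Disjoint (G f) (G g))
    (Kf : Fin n → Set E3) (hKc : ∀ f, IsCompact (Kf f)) (hKv : ∀ f, Convex ℝ (Kf f))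
    (hK0 : ∀ f, (0 : E3) ∈ Kf f) (hKs : ∀ f, -Kf f = Kf f)
    (B : Finset (Fin n)) (KB : Set E3) (hBc : IsCompact KB) (hBv : Convex ℝ KB) (hB0 : (0 : E3) ∈ KB)
    (hBs : -KB = KB) {R : ℝ} (hR : 0 < R) (hBR : KB ⊆ closedBall (0 : E3) R)
    (hsub : ∀ f ∈ B, KB ⊆ Kf f) :
    3 * (volume KB).toReal ^ ((1 : ℝ) / 3) * (volume (⋃ f ∈ B, G f)).toReal ^ ((2 : ℝ) / 3) -
      R * (∑ f ∈ B, ∑ g ∈ Finset.univ \ B,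
        (per (closedBall (0 : E3) 1) (G f) + per (closedBall (0 : E3) 1) (G g) -
          per (closedBall (0 : E3) 1) (G f ∪ G g)) / 2) ≤
      ∑ f ∈ B, (per (Kf f) (G f) - ∑ g, (if f = g then 0 else
        (per (Kf f) (G f) + per (Kf f) (G g) - per (Kf f) (G f ∪ G g)) / 2)) := by
  classical
  have hvol : ∀ f, volume (G f) < ⊤ := fun f => (hfin f).2
  -- monotonicity: replace the bodies on `B` by `KB`
  have hmono := blockFreeEnergy_mono G hPoly hvol hdisjG Kf hKc hKv hK0 hKs (fun _ => KB)
    (fun _ => hBc) (fun _ => hBv) (fun _ => hB0) (fun _ => hBs) B hsub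
  refine le_trans ?_ hmono
  -- the block's free energy is that of the merged block
  rw [freeEnergy_class_eq_merged G hPoly hvol hdisjG hBc hBv hB0 hBs B]
  -- Wulff for the merged block
  obtain ⟨hmeas, hvolB, hperB, -⟩ := subfamily_union_facts G hfin hdisjG B
  have hWulff : 3 * (volume KB).toReal ^ ((1 : ℝ) / 3) * (volume (⋃ f ∈ B, G f)).toReal ^ ((2 : ℝ) / 3) ≤
      per KB (⋃ f ∈ B, G f) :=
    wulff_le_per hBc hBv hB0 ⟨hmeas, lt_top_iff_ne_top.2 hperB⟩ hvolB
  -- the interfaces of the merged block, grain by grain, charged at most `R`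
  obtain ⟨k, H, ν, S, SX, hcross, -, -⟩ := exists_exterior_crossSums G hPoly hvol hdisjG
  have hιle : ∀ f g, f ≠ g → per KB (G f) + per KB (G g) - per KB (G f ∪ G g) ≤
      R * (per (closedBall (0 : E3) 1) (G f) + per (closedBall (0 : E3) 1) (G g) -
        per (closedBall (0 : E3) 1) (G f ∪ G g)) := by
    intro f g hfg
    have hRc : IsCompact (closedBall (0 : E3) R) := isCompact_closedBall 0 _
    have hRv : Convex ℝ (closedBall (0 : E3) R) := convex_closedBall 0 _
    have hR0 : (0 : E3) ∈ closedBall (0 : E3) R := mem_closedBall_self hR.le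
    have h1 := hcross KB hBc hBv hB0 f g hfg
    have h2 := hcross (closedBall (0 : E3) R) hRc hRv hR0 f g hfg
    have hm := crossSum_mono hBR isBounded_closedBall ⟨0, hB0⟩ H ν (S f) (S g)
    rw [← h1, ← h2, per_closedBall_eq_mul_perimeter hR, per_closedBall_eq_mul_perimeter hR,
      per_closedBall_eq_mul_perimeter hR] at hm
    rw [per_closedBall_eq_mul_perimeter one_pos, per_closedBall_eq_mul_perimeter one_pos,
      per_closedBall_eq_mul_perimeter one_pos]
    linarith
  have hover : (∑ g ∈ Finset.univ \ B,
      (per KB (⋃ f ∈ B, G f) + per KB (G g) - per KB ((⋃ f ∈ B, G f) ∪ G g)) / 2) ≤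
      R * (∑ f ∈ B, ∑ g ∈ Finset.univ \ B,
        (per (closedBall (0 : E3) 1) (G f) + per (closedBall (0 : E3) 1) (G g) -
          per (closedBall (0 : E3) 1) (G f ∪ G g)) / 2) := by
    have hadd : ∀ g ∈ Finset.univ \ B,
        (per KB (⋃ f ∈ B, G f) + per KB (G g) - per KB ((⋃ f ∈ B, G f) ∪ G g)) / 2 ≤
        ∑ f ∈ B, R * ((per (closedBall (0 : E3) 1) (G f) + per (closedBall (0 : E3) 1) (G g) -
          per (closedBall (0 : E3) 1) (G f ∪ G g)) / 2) := by
      intro g hg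
      have hg' : g ∉ B := (Finset.mem_sdiff.1 hg).2
      rw [two_iota_biUnion_left G hPoly hvol hdisjG hBc hBv hB0 hBs hg', Finset.sum_div]
      refine Finset.sum_le_sum fun f hf => ?_
      have hfg : f ≠ g := fun h => hg' (h ▸ hf)
      have := hιle f g hfg
      have hR0 : 0 ≤ R := hR.le
      linarith
    calc (∑ g ∈ Finset.univ \ B,
          (per KB (⋃ f ∈ B, G f) + per KB (G g) - per KB ((⋃ f ∈ B, G f) ∪ G g)) / 2)
        ≤ ∑ g ∈ Finset.univ \ B, ∑ f ∈ B, R * ((per (closedBall (0 : E3) 1) (G f) +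
            per (closedBall (0 : E3) 1) (G g) - per (closedBall (0 : E3) 1) (G f ∪ G g)) / 2) :=
          Finset.sum_le_sum hadd
      _ = R * (∑ f ∈ B, ∑ g ∈ Finset.univ \ B,
            (per (closedBall (0 : E3) 1) (G f) + per (closedBall (0 : E3) 1) (G g) -
              per (closedBall (0 : E3) 1) (G f ∪ G g)) / 2) := by
          rw [Finset.sum_comm, Finset.mul_sum]
          exact Finset.sum_congr rfl fun f _ => by rw [Finset.mul_sum]
  linarith

/-- **Row «floor»**: `r · (free Euclidean area of the block) ≤ F_B` when `B̄(0, r) ⊆ K_f` on `B`. -/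
theorem floor_le_blockFreeEnergy {n : ℕ} (G : Fin n → Set E3)
    (hPoly : ∀ f, ∃ (k : ℕ) (H : Fin k → Finset (E3 × ℝ)), G f = ⋃ i, polytope (H i))
    (hvol : ∀ f, volume (G f) < ⊤) (hdisjG : ∀ f g, f ≠ g → Disjoint (G f) (G g))
    (Kf : Fin n → Set E3) (hKc : ∀ f, IsCompact (Kf f)) (hKv : ∀ f, Convex ℝ (Kf f))
    (hK0 : ∀ f, (0 : E3) ∈ Kf f) (hKs : ∀ f, -Kf f = Kf f) {r : ℝ} (hr : 0 < r)
    (B : Finset (Fin n)) (hball : ∀ f ∈ B, closedBall (0 : E3) r ⊆ Kf f) :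
    r * (∑ f ∈ B, (per (closedBall (0 : E3) 1) (G f) - ∑ g, (if f = g then 0 else
        (per (closedBall (0 : E3) 1) (G f) + per (closedBall (0 : E3) 1) (G g) -
          per (closedBall (0 : E3) 1) (G f ∪ G g)) / 2))) ≤
      ∑ f ∈ B, (per (Kf f) (G f) - ∑ g, (if f = g then 0 else
        (per (Kf f) (G f) + per (Kf f) (G g) - per (Kf f) (G f ∪ G g)) / 2)) := by
  have hBc : IsCompact (closedBall (0 : E3) r) := isCompact_closedBall 0 r
  have hBv : Convex ℝ (closedBall (0 : E3) r) := convex_closedBall 0 r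
  have hB0 : (0 : E3) ∈ closedBall (0 : E3) r := mem_closedBall_self hr.le
  have hBs : -closedBall (0 : E3) r = closedBall 0 r := by rw [neg_closedBall, neg_zero]
  have hmono := blockFreeEnergy_mono G hPoly hvol hdisjG Kf hKc hKv hK0 hKs (fun _ => closedBall 0 r)
    (fun _ => hBc) (fun _ => hBv) (fun _ => hB0) (fun _ => hBs) B hball
  refine le_trans (le_of_eq ?_) hmono
  rw [Finset.mul_sum]
  exact Finset.sum_congr rfl fun f _ => (freeArea_eq_mul G hr f).symm

end Summit.Ventures.Crystal3D.Theorems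

end
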